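import Mathlib
import HarnessLib
import Literature.Analysis.FluidPDE.OseenZoomCovariance
import Summits.NavierStokesRegularity.NavierStokesRegularity.Theorems.LocalSineTubeDoorProfileAlignedWindowRigidityAncient
import Summits.NavierStokesRegularity.NavierStokesRegularity.Theorems.RigidMotionDoorRigidFlow

/-!
# RigidMotionDoor — forward propagation of an infinitesimal rigid-motion symmetry in the Oseen class

Route `RigidMotionDoor` (ns-idea-6 LINE g5-3 «stabilisation»; planner ns-idea-6, critic idea-crit-4), crux
`EuclidAccumulation` (stmt-NavierStokesRegularity-27902): the LOAD-BEARING stub `stub_forwardRigidSymmetry` of the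
birth skeleton `EuclidAccumulation_birth.lean`, UNFOLDED (`rigidMotionDoor_stub_forwardRigidSymmetry`, statement
token-identical with the skeleton's `StubForwardRigidSymmetry`).

Mechanism (finite motions, not the linearised equation), exactly as the skeleton's docstring prescribes:
* `rigid_eq_forward` — equivariance of ONE slice under an affine isometry `y ↦ L y + a` (`v(s)(L y + a) = L v(s)(y)`)
  propagates to every later slice: the pulled-back field `L⁻¹ v(t, L · + a)` solves the same Oseen integral equation
  from the same slice (caloric / Duhamel covariance under linear isometries `heatExtension_conj_linearIsometryEquiv`,
  `oseenDuhamel_symm_conj_linearIsometryEquiv` and translations `heatExtension_comp_add_right`,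
  `oseenDuhamel_comp_add_right`), so bounded Oseen-mild forward uniqueness `oseenMild_bounded_unique`
  [KochNadirashviliSereginSverak2009 §4] identifies the two (continuous slices a.e. equal coincide) — the affine
  merge of the tree's `conj_eq_forward` / `translate_eq_forward`;
* the stub: slices are differentiable (`analyticOnNhd_uncurry`); split `e = B c + e₂`, `B e₂ = 0`
  (`RigidMotionDoorRigidFlow.exists_range_add_ker`); INTEGRATE the infinitesimal symmetry of `v(s₁)` along the screw
  flow `g_τ(y) = exp(τB) y + (exp(τB) c − c + τ e₂)` of the Killing field (`apply_flow_eq_of_fderiv`): `v(s₁)(g_τ y) = exp(τB) v(s₁)(y)`; propagate each finite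
  symmetry `(exp(τB), exp(τB)c − c + τe₂)` forward by `rigid_eq_forward`; DIFFERENTIATE at `τ = 0` on the later
  slice (`fderiv_eq_of_apply_flow`).

Prover ns-imp-p1 g4 (author; text verbatim from pub/pub-ns-dss/ns-imp-p1/rmd/, sha16 e0bbbfa9cdc8499c); landed by ns-tc-p1 g5 as the
hand keyed by DIRECTOR-NS #233 (one writer, no re-proof).  WHAT THIS IS NOT: a lemma about HYPOTHETICAL Type-I blow-up profiles (the route's Oseen
class); no statement about Navier–Stokes regularity is proved or claimed.
-/

noncomputable section

-- the summit and its single problem share the name (D-0017 nested layout)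
set_option linter.dupNamespace false

namespace Summit.NavierStokesRegularity.NavierStokesRegularity.Theorems.RigidMotionDoorForwardRigidSymmetry

open MeasureTheory Set Function Filter Topology
open scoped RealInnerProductSpace InnerProductSpace
open Literature.Analysis Literature.Analysis.FluidPDE
open Summit.NavierStokesRegularity.NavierStokesRegularity.Theorems.LocalSineTubeDoorProfileAlignedWindowRigidityAncient
open Summit.NavierStokesRegularity.NavierStokesRegularity.Theorems.RigidMotionDoorRigidFlow

variable {v : ℝ → EuclideanSpace ℝ (Fin 3) → EuclideanSpace ℝ (Fin 3)}

/-- **Rigid-motion equivariance propagates FORWARD** (bounded Oseen-mild uniqueness): if the slice `v(s)` is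
equivariant under the affine isometry `y ↦ L y + a`, `v(s)(L y + a) = L (v(s) y)`, so is every later slice `v(t)`,
`s ≤ t < 0` — the pulled-back field `L⁻¹ v(t)(L · + a)` solves the same Oseen integral equation from the same slice. -/
theorem rigid_eq_forward (hcont : ContinuousOn (uncurry v) (Iio (0 : ℝ) ×ˢ univ))
    (hbdd : ∀ δ : ℝ, 0 < δ → ∃ B : ℝ, ∀ t < -δ, ∀ y : EuclideanSpace ℝ (Fin 3), ‖v t y‖ ≤ B)
    (hmild : ∀ s t : ℝ, s < t → t < 0 → ∀ y,
      v t y = UnboundedOperators.heatExtension (v s) (t - s) y - oseenDuhamel 1 s v v t y)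
    (L : EuclideanSpace ℝ (Fin 3) ≃ₗᵢ[ℝ] EuclideanSpace ℝ (Fin 3)) (a : EuclideanSpace ℝ (Fin 3)) {s : ℝ}
    (h : ∀ y, v s (L y + a) = L (v s y)) :
    ∀ t, s ≤ t → t < 0 → ∀ y, v t (L y + a) = L (v t y) := by
  intro t hst ht0
  rcases hst.eq_or_lt with rfl | hst'
  · exact h
  intro y
  set w : ℝ → EuclideanSpace ℝ (Fin 3) → EuclideanSpace ℝ (Fin 3) := fun τ x => L.symm (v τ (L x + a)) with hw
  obtain ⟨T₂, htT₂, hT₂0⟩ : ∃ T₂ : ℝ, t < T₂ ∧ T₂ < 0 := ⟨t / 2, by linarith, by linarith⟩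
  obtain ⟨B, hB⟩ := hbdd (-T₂) (by linarith)
  have hB' : ∀ τ ∈ Ioo s T₂, ∀ y, ‖v τ y‖ ≤ max B 0 := fun τ hτ y =>
    (hB τ (by linarith [hτ.2]) y).trans (le_max_left _ _)
  have hsub : Ioo s T₂ ×ˢ (univ : Set (EuclideanSpace ℝ (Fin 3))) ⊆ Iio 0 ×ˢ univ :=
    prod_mono (fun τ hτ => hτ.2.trans hT₂0) Subset.rfl
  have hum : AEStronglyMeasurable (uncurry v) (volume.restrict (Ioo s T₂ ×ˢ univ)) :=
    (hcont.mono hsub).aestronglyMeasurable (measurableSet_Ioo.prod MeasurableSet.univ)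
  have hcontw : ContinuousOn (uncurry w) (Ioo s T₂ ×ˢ univ) := by
    have h1 : Continuous (fun z : ℝ × EuclideanSpace ℝ (Fin 3) => (z.1, L z.2 + a)) :=
      continuous_fst.prodMk ((L.continuous.comp continuous_snd).add continuous_const)
    have h2 : MapsTo (fun z : ℝ × EuclideanSpace ℝ (Fin 3) => (z.1, L z.2 + a)) (Ioo s T₂ ×ˢ univ)
        (Iio (0 : ℝ) ×ˢ univ) := fun z hz =>
      mem_prod.2 ⟨(mem_prod.1 hz).1.2.trans hT₂0, mem_univ _⟩
    exact L.symm.continuous.comp_continuousOn (hcont.comp h1.continuousOn h2)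
  have hwm : AEStronglyMeasurable (uncurry w) (volume.restrict (Ioo s T₂ ×ˢ univ)) :=
    hcontw.aestronglyMeasurable (measurableSet_Ioo.prod MeasurableSet.univ)
  have hwM : ∀ τ ∈ Ioo s T₂, ∀ y, ‖w τ y‖ ≤ max B 0 := fun τ hτ y => by
    simp only [hw, LinearIsometryEquiv.norm_map]
    exact hB' τ hτ (L y + a)
  have hu : ∀ τ ∈ Ioo s T₂, v τ =ᵐ[volume] fun x =>
      UnboundedOperators.heatExtension (v s) (τ - s) x - oseenDuhamel 1 s v v τ x :=
    fun τ hτ => Eventually.of_forall fun x => hmild s τ hτ.1 (hτ.2.trans hT₂0) x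
  have hslice : (fun y => L.symm (v s (L y + a))) = v s := by
    funext x
    rw [h x, LinearIsometryEquiv.symm_apply_apply]
  have hv₂ : ∀ τ ∈ Ioo s T₂, w τ =ᵐ[volume] fun x =>
      UnboundedOperators.heatExtension (v s) (τ - s) x - oseenDuhamel 1 s w w τ x := by
    intro τ hτ
    refine Eventually.of_forall fun x => ?_
    -- the caloric term
    have h1 : L.symm (UnboundedOperators.heatExtension (v s) (τ - s) (L x + a)) =
        UnboundedOperators.heatExtension (v s) (τ - s) x := by
      rw [← heatExtension_comp_add_right (v s) a (τ - s) (L x)]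
      have e1 := heatExtension_conj_linearIsometryEquiv L.symm (fun y => v s (y + a)) (τ - s) x
      simp only [LinearIsometryEquiv.symm_symm] at e1
      rw [← e1, hslice]
    -- the Duhamel term
    have h2 : oseenDuhamel 1 s w w τ x = L.symm (oseenDuhamel 1 s v v τ (L x + a)) := by
      rw [← oseenDuhamel_comp_add_right 1 s v v a τ (L x),
        ← oseenDuhamel_symm_conj_linearIsometryEquiv L 1 s (fun τ y => v τ (y + a)) (fun τ y => v τ (y + a)) τ x]
    show w τ x = UnboundedOperators.heatExtension (v s) (τ - s) x - oseenDuhamel 1 s w w τ x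
    rw [h2, ← h1, ← map_sub, ← hmild s τ hτ.1 (hτ.2.trans hT₂0) (L x + a)]
  have hae := oseenMild_bounded_unique
    (U := fun τ x => UnboundedOperators.heatExtension (v s) (τ - s) x)
    one_pos (le_max_right B 0) hum hwm hB' hwM hu hv₂
  have ht : t ∈ Ioo s T₂ := ⟨hst', htT₂⟩
  have hg : Continuous (w t) :=
    L.symm.continuous.comp ((continuous_slice hcont ht0).comp (L.continuous.add continuous_const))
  have heq : v t = w t := ((continuous_slice hcont ht0).ae_eq_iff_eq volume hg).1 (hae t ht)
  have hy := congrFun heq y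
  rw [hy]
  simp only [hw, LinearIsometryEquiv.apply_symm_apply]

/-- **Stub `stub_forwardRigidSymmetry` of the `EuclidAccumulation` birth skeleton** (M, LOAD-BEARING; statement
token-identical with the skeleton's `StubForwardRigidSymmetry`, unfolded): in the route's Type-I Oseen class an
infinitesimal rigid-motion symmetry `(B, e)` (`B` skew) of ONE slice `v(s₁)` — `Dv(s₁)(y)[B y + e] = B v(s₁)(y)` for
all `y` — is a symmetry of every LATER slice `v(s₂)`, `s₁ ≤ s₂ < 0` (KNSS 2009 §4 forward uniqueness of bounded
mild solutions, tree `oseenMild_bounded_unique`, after integrating to finite rigid motions). -/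
theorem rigidMotionDoor_stub_forwardRigidSymmetry :
    ∀ (C : ℝ) (v : ℝ → EuclideanSpace ℝ (Fin 3) → EuclideanSpace ℝ (Fin 3)),
    Literature.Analysis.FluidPDE.HasTypeITimeDecay C v →
    ContinuousOn (Function.uncurry v) (Set.Iio (0 : ℝ) ×ˢ Set.univ) →
    (∀ s t : ℝ, s < t → t < 0 → ∀ x, v t x =
        Literature.Analysis.UnboundedOperators.heatExtension (v s) (t - s) x
          - Literature.Analysis.FluidPDE.oseenDuhamel 1 s v v t x) →
    (∀ t < 0, Literature.Analysis.FluidPDE.VectorCalculus.IsDivFree (v t)) →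
    ∀ (B : EuclideanSpace ℝ (Fin 3) →L[ℝ] EuclideanSpace ℝ (Fin 3)) (e : EuclideanSpace ℝ (Fin 3)),
      (∀ x, inner ℝ (B x) x = 0) →
      ∀ s₁ s₂ : ℝ, s₁ ≤ s₂ → s₂ < 0 →
        (∀ y, fderiv ℝ (v s₁) y (B y + e) - B (v s₁ y) = 0) →
        ∀ y, fderiv ℝ (v s₂) y (B y + e) - B (v s₂ y) = 0 := by
  intro C v hdecay hcont hmild _hdiv B e hskew s₁ s₂ h12 h2 hsym y
  have h1 : s₁ < 0 := lt_of_le_of_lt h12 h2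
  have hbdd := bdd_of_hasTypeITimeDecay hdecay
  -- slices are differentiable (jointly real-analytic Oseen-ancient field)
  have hdiff : ∀ t < 0, Differentiable ℝ (v t) := by
    intro t ht x
    have hA := analyticOnNhd_uncurry hcont hbdd hmild (t, x) (mem_prod.2 ⟨ht, mem_univ _⟩)
    exact hA.differentiableAt.comp x ((differentiableAt_const t).prodMk differentiableAt_id)
  -- split `e = B c + e₂`, `B e₂ = 0`
  obtain ⟨c, e₂, he₂, rfl⟩ := exists_range_add_ker hskew e
  -- integrate the infinitesimal symmetry of the slice `s₁` along the screw flow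
  have hfin₁ : ∀ (τ : ℝ) (z : EuclideanSpace ℝ (Fin 3)),
      v s₁ (NormedSpace.exp (τ • B) z + (NormedSpace.exp (τ • B) c - c + τ • e₂)) = NormedSpace.exp (τ • B) (v s₁ z) :=
    apply_flow_eq_of_fderiv B c he₂ (hdiff s₁ h1) (fun z => sub_eq_zero.1 (hsym z))
  -- propagate every finite symmetry (a rigid motion: rotation `exp(τB)` plus a translation) forward to `s₂`
  have hfin₂ : ∀ (τ : ℝ) (z : EuclideanSpace ℝ (Fin 3)),
      v s₂ (NormedSpace.exp (τ • B) z + (NormedSpace.exp (τ • B) c - c + τ • e₂)) = NormedSpace.exp (τ • B) (v s₂ z) := by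
    intro τ z
    set L : EuclideanSpace ℝ (Fin 3) ≃ₗᵢ[ℝ] EuclideanSpace ℝ (Fin 3) :=
      Unitary.linearIsometryEquiv ⟨NormedSpace.exp (τ • B), exp_smul_mem_unitary hskew τ⟩ with hL
    have hLapp : ∀ w, L w = NormedSpace.exp (τ • B) w := fun w => rfl
    have hτ₁ : ∀ z, v s₁ (L z + (NormedSpace.exp (τ • B) c - c + τ • e₂)) = L (v s₁ z) := fun z => by
      rw [hLapp, hLapp]
      exact hfin₁ τ z
    have hτ₂ := rigid_eq_forward hcont hbdd hmild L (NormedSpace.exp (τ • B) c - c + τ • e₂) hτ₁ s₂ h12 h2 z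
    rwa [hLapp, hLapp] at hτ₂
  -- differentiate at `τ = 0`
  exact sub_eq_zero.2 (fderiv_eq_of_apply_flow B c he₂ (hdiff s₂ h2) hfin₂ y)

end Summit.NavierStokesRegularity.NavierStokesRegularity.Theorems.RigidMotionDoorForwardRigidSymmetry

end
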